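import Literature.AnabelianGeometry.SemiGraphs.TemperedAnabelianThm68PiFunctorOfThm64
import Literature.AnabelianGeometry.AbsoluteAnabelian.MLFSlimKummerProofs

/-!
# [SemiAnbd] Thm. 6.8 (i) ⟸ Thm. 6.4, with the `K`-morphism dictionary made purely definitional
# (uniqueness of the Galois element from the slimness of `G_{ℚ_p}`, [AbsAnab] Thm. 1.1.1 (ii))

Mochizuki, *Semi-graphs of anabelioids*, Publ. RIMS **42** (2006) [SemiAnbd], §6, Thm. 6.8 (i)
(ms. p. 74; proof p. 75 "follows by exactly the same arguments as … [Mzk8], Theorem 2.3") and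
[GalSect] = *Galois sections in absolute anabelian geometry*, Nagoya Math. J. **179** (2005), proof
of Thm. 2.3 (p. 9): "assertion (i) follows formally from Theorem 1.2"; the `K`-structure convention
of [GalSect] p. 7: "by stipulating that all schemes … be equipped with `K`-structures … and that all
morphisms be `K`-morphisms, we obtain a category `DLoc_K(X_K)` together with a natural faithful
functor `DLoc_K(X_K) → DLoc(X_K)`". [cite: MochizukiSemiAnbd2006, Thm 6.8(i) pp.74-75]
[cite: MochizukiGalSect2005, Thm 2.3 p.9] [cite: MochizukiGalSect2005, Def 2.1 p.7]

PROOF-ONLY companion of `TemperedAnabelianThm68PiFunctorOfThm64.lean` (no definitions, no new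
named facts; abc-iut cell, layer L3, D-0079 L-F pack D).  There, the morphism half of Thm. 6.8 (i)
(sub-DAG node T68i-L04 `Thm68Sub.PiFunctorBijectiveOnHom`) was derived from [SemiAnbd] Thm. 6.4 as
typed plus a `K`-morphism dictionary whose range law read "a dominant morphism `f : Z → Z'` such that
SOME element of `G_{ℚ_p}` realising the Galois square of `π₁^temp(f)` lies in `G_K` is a
`K`-morphism" — sound at genuine data only because the realising element is UNIQUE, i.e. by the
slimness of `G_{ℚ_p}` ([AbsAnab] Thm. 1.1.1 (ii)).  This file moves that ingredient INTO THE KERNEL: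
the slimness of `G_{ℚ_p}` is the tree's PROVED theorem
`Literature.AnabelianGeometry.AbsoluteAnabelian.galoisMLF_slim_holds` (FACT-LIST F-0027, discharged
unconditionally), whence the element of `G_{ℚ_p}` realising the Galois square of any map
`Π^temp_Z → Π^temp_{Z'}` is unique (`TemperedCurve.galoisElement_unique`), and the dictionary's range
law is SHARPENED to the purely definitional "a dominant morphism `f` such that EVERY element realising
the Galois square of `π₁^temp(f)` lies in `G_K` — i.e. `f` induces the identity on `K` — is a
`K`-morphism" (`hrangeK`), which holds at genuine data by the definition of `DLoc_K(X_K)` alone.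
Main results: `Thm68Sub.piFunctorBijectiveOnHom_of_temperedAnabelianTheorem_of_KMorphismLaw`, the
origin-level `TemperedMorphismOrigin.piFunctorBijectiveOnHom_of_temperedAnabelianTheoremHolds_of_KMorphismLaw`
(conclusion literally the binder `hL04` of the Thm. 6.8 closers of record) and the re-knit closer for
Thm. 6.8 (i)(ii) in genuine-morphism form (F-1698).  Honest framing: Thm. 6.4 stays an assumption
LABEL on OUR typed statements; the dictionary is an origin-closure clause relating two INTERFACE data
(`DLocSchemeData`, `TemperedCurveHom`); nothing of [SemiAnbd] §6 / [GalSect] is discharged; no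
statement is strengthened; nothing here takes a side on [IUTchIII] Cor. 3.12.
-/

noncomputable section

namespace Literature.AnabelianGeometry.SemiGraphs

open scoped Pointwise
open CategoryTheory Topology

variable {p : ℕ} [Fact p.Prime]

/-! ### Slimness of `G_{ℚ_p}` read on the §6 interface -/

/-- **Slimness of `G_{ℚ_p}` at an open subgroup `G_K`** ([AbsAnab] Thm. 1.1.1 (ii), the tree's
PROVED `galoisMLF_slim_holds`, at the MLF `ℚ_p`): an element of `G_{ℚ_p}` commuting with every
element of `G_K = Gal(K̄/K)`, `K/ℚ_p` finite, is trivial (`G_K` is open in the Krull topology,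
Mathlib `IntermediateField.fixingSubgroup_isOpen`). [cite: MochizukiAbsAnab2004, Thm 1.1.1 (ii) p.6] -/
theorem GQp_eq_one_of_forall_fixingSubgroup_commute
    (K : IntermediateField ℚ_[p] (AlgebraicClosure ℚ_[p])) [FiniteDimensional ℚ_[p] K] (g : GQp p)
    (h : ∀ σ ∈ K.fixingSubgroup, σ * g = g * σ) : g = 1 := by
  have hslim := Literature.AnabelianGeometry.AbsoluteAnabelian.galoisMLF_slim_holds p ℚ_[p]
  -- `Field.absoluteGaloisGroup ℚ_p` is `G_{ℚ_p}` (the identity `toAlgEquiv`); transport along it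
  set e := Field.absoluteGaloisGroup.toAlgEquiv ℚ_[p] with he
  set H' : Subgroup (Field.absoluteGaloisGroup ℚ_[p]) := K.fixingSubgroup.comap e.toMonoidHom
    with hH'
  have hopen' : IsOpen (K.fixingSubgroup : Set (GQp p)) := K.fixingSubgroup_isOpen
  have hopen : IsOpen (H' : Set (Field.absoluteGaloisGroup ℚ_[p])) := hopen'
  have hbot := hslim.centralizer_eq_bot H' hopen
  have hg : e.symm g ∈ Subgroup.centralizer (H' : Set (Field.absoluteGaloisGroup ℚ_[p])) := by
    rw [Subgroup.mem_centralizer_iff]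
    intro σ hσ
    apply e.injective
    rw [map_mul, map_mul, MulEquiv.apply_symm_apply]
    exact h (e σ) hσ
  rw [hbot, Subgroup.mem_bot] at hg
  calc g = e (e.symm g) := (e.apply_symm_apply g).symm
    _ = 1 := by rw [hg, map_one]

namespace TemperedCurve

/-- **The element of `G_{ℚ_p}` realising the Galois square of a map `Π^temp_{X_K} → Π^temp_{Y_L}` is
unique** ([SemiAnbd] Thm. 6.4, p. 70: "the induced morphism `G_K → G_L`"): if
`(Π^temp_{Y_L} → G_{ℚ_p}) ∘ φ = Inn(g₁) ∘ (Π^temp_{X_K} → G_{ℚ_p}) = Inn(g₂) ∘ (Π^temp_{X_K} → G_{ℚ_p})`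
then `g₁ = g₂`, because `g₂⁻¹ g₁` centralises `G_K = aug(Π^temp_{X_K})` (`range_aug`), which is open
in the slim group `G_{ℚ_p}`. [cite: MochizukiSemiAnbd2006, Thm 6.4 pp.70-71]
[cite: MochizukiAbsAnab2004, Thm 1.1.1 (ii) p.6] -/
theorem galoisElement_unique (X Y : TemperedCurve p) (φ : X.PiTemp → Y.PiTemp) (g₁ g₂ : GQp p)
    (h₁ : ∀ x, Y.aug (φ x) = g₁ * X.aug x * g₁⁻¹) (h₂ : ∀ x, Y.aug (φ x) = g₂ * X.aug x * g₂⁻¹) :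
    g₁ = g₂ := by
  haveI := X.finiteDimensional_K
  have h21 : g₂⁻¹ * g₁ = 1 := by
    refine GQp_eq_one_of_forall_fixingSubgroup_commute X.K (g₂⁻¹ * g₁) fun σ hσ => ?_
    rw [← X.range_aug] at hσ
    obtain ⟨x, rfl⟩ := hσ
    have hx : g₁ * X.aug x * g₁⁻¹ = g₂ * X.aug x * g₂⁻¹ := by rw [← h₁ x, h₂ x]
    change X.aug x * (g₂⁻¹ * g₁) = g₂⁻¹ * g₁ * X.aug x
    calc X.aug x * (g₂⁻¹ * g₁) = g₂⁻¹ * (g₂ * X.aug x * g₂⁻¹) * g₁ := by group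
      _ = g₂⁻¹ * (g₁ * X.aug x * g₁⁻¹) * g₁ := by rw [hx]
      _ = g₂⁻¹ * g₁ * X.aug x := by group
  calc g₁ = g₂ * (g₂⁻¹ * g₁) := by group
    _ = g₂ := by rw [h21, mul_one]

end TemperedCurve

namespace Thm68Sub

variable {X : TemperedCurve p}

/-- **The definitional range law implies the range law of `piFunctor_map_surjective_of_thm64`**: if
every dominant morphism `f : Z → Z'` such that EVERY element of `G_{ℚ_p}` realising the Galois square
of `π₁^temp(f)` lies in `G_K` (i.e. `f` induces the identity on `K`: "`K`-morphism", [GalSect] p. 7) is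
in the range of `ι`, then so is every `f` for which SOME realising element lies in `G_K` — realising
elements being unique (`TemperedCurve.galoisElement_unique`, slimness of `G_{ℚ_p}`).
[cite: MochizukiGalSect2005, Def 2.1 p.7] [cite: MochizukiAbsAnab2004, Thm 1.1.1 (ii) p.6] -/
theorem rangeLaw_of_KMorphismLaw {Z Z' : TemperedCurve p} (C : TemperedCurveHom p Z Z')
    {M : Type*} (ι : M → C.DomHom)
    (hrangeK : ∀ f : C.DomHom, (∃ g : GQp p, ∀ x, Z'.aug (C.pi1 f x) = g * Z.aug x * g⁻¹) →
      (∀ g : GQp p, (∀ x, Z'.aug (C.pi1 f x) = g * Z.aug x * g⁻¹) → g ∈ X.GK) → f ∈ Set.range ι) :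
    ∀ f : C.DomHom, (∃ g ∈ X.GK, ∀ x, Z'.aug (C.pi1 f x) = g * Z.aug x * g⁻¹) → f ∈ Set.range ι := by
  rintro f ⟨g₀, hg₀K, hg₀⟩
  refine hrangeK f ⟨g₀, hg₀⟩ fun g hg => ?_
  rw [TemperedCurve.galoisElement_unique Z Z' (fun x => C.pi1 f x) g g₀ hg hg₀]
  exact hg₀K

/-- **T68i-L04 `PiFunctorBijectiveOnHom` DERIVED from [SemiAnbd] Thm. 6.4 with the purely
definitional `K`-morphism dictionary** ([GalSect] p. 9 "assertion (i) follows formally from Theorem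
1.2", p. 7 `K`-structures): as `piFunctorBijectiveOnHom_of_temperedAnabelianTheorem`, with the range
law SHARPENED to "`f ∈ range ι` whenever every element of `G_{ℚ_p}` realising the Galois square of
`π₁^temp(f)` lies in `G_K`" — the uniqueness of that element being supplied in the kernel by the
slimness of `G_{ℚ_p}` ([AbsAnab] Thm. 1.1.1 (ii), PROVED in the tree). The remaining dictionary
hypotheses: `ι` injective (faithful functor `DLoc_K(X_K) → DLoc(X_K)`), `C.pi1 ∘ ι = D.pi1`, the
identifications `J_Z ≅ Π^temp_Z` over `G_K`, and `K ⊆ K_Z`.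
[cite: MochizukiSemiAnbd2006, Thm 6.8(i) pp.74-75] [cite: MochizukiGalSect2005, Thm 2.3 p.9] -/
theorem piFunctorBijectiveOnHom_of_temperedAnabelianTheorem_of_KMorphismLaw (D : DLocSchemeData X)
    (C : ∀ Z Z' : D.DLocK, TemperedCurveHom p (D.curve Z) (D.curve Z'))
    (ι : letI := D.catK; ∀ Z Z' : D.DLocK, (Z ⟶ Z') → (C Z Z').DomHom)
    (hι : ∀ Z Z' : D.DLocK, Function.Injective (ι Z Z'))
    (hpi : letI := D.catK; ∀ (Z Z' : D.DLocK) (f : Z ⟶ Z'), (C Z Z').pi1 (ι Z Z' f) = D.pi1 f)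
    (hrangeK : ∀ (Z Z' : D.DLocK) (f : (C Z Z').DomHom),
      (∃ g : GQp p, ∀ x, (D.curve Z').aug ((C Z Z').pi1 f x) = g * (D.curve Z).aug x * g⁻¹) →
      (∀ g : GQp p, (∀ x, (D.curve Z').aug ((C Z Z').pi1 f x) = g * (D.curve Z).aug x * g⁻¹) →
        g ∈ X.GK) → f ∈ Set.range (ι Z Z'))
    (hK : ∀ Z : D.DLocK, X.K ≤ (D.curve Z).K)
    (haug : letI := D.catK; letI := DLocObj.dlocCategory X;
      ∀ (Z : D.DLocK) (j : (D.pi1Functor.obj Z).J),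
        (D.curve Z).aug (D.objIso Z j) = (D.pi1Functor.obj Z).augJ j)
    (h64 : ∀ Z Z' : D.DLocK, TemperedAnabelianTheorem (C Z Z')) :
    PiFunctorBijectiveOnHom X D :=
  piFunctorBijectiveOnHom_of_temperedAnabelianTheorem D C ι hι hpi
    (fun Z Z' => rangeLaw_of_KMorphismLaw (C Z Z') (ι Z Z') (hrangeK Z Z')) hK haug h64

end Thm68Sub

/-! ### Origin level -/

namespace TemperedMorphismOrigin

open Thm68Sub

/-- **T68i-L04 over the origin hypotheses from [SemiAnbd] Thm. 6.4 as printed (F-1693, BY NAME),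
with the purely definitional `K`-morphism dictionary at certified data**: as
`piFunctorBijectiveOnHom_of_temperedAnabelianTheoremHolds`, the range law of `hdict` SHARPENED to
"every dominant morphism all of whose Galois-square elements lie in `G_K` (i.e. inducing the identity
on `K`) is a `K`-morphism"; slimness of `G_{ℚ_p}` supplied in the kernel.  Conclusion LITERALLY the
binder `hL04` of the Thm. 6.8 closers of record. [cite: MochizukiSemiAnbd2006, Thm 6.8(i) pp.74-75]
[cite: MochizukiGalSect2005, Thm 2.3 p.9] -/
theorem piFunctorBijectiveOnHom_of_temperedAnabelianTheoremHolds_of_KMorphismLaw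
    (Ω : TemperedMorphismOrigin p) (h64 : Ω.TemperedAnabelianTheoremHolds)
    (hcurve : ∀ (X : TemperedCurve p) (D : DLocSchemeData X) (Z : D.DLocK),
      Ω.IsHyperbolicCurveOrigin X → Ω.IsDLocOrigin D.toDLocContext →
        Ω.IsHyperbolicCurveOrigin (D.curve Z))
    (hK : ∀ (X : TemperedCurve p) (D : DLocSchemeData X) (Z : D.DLocK),
      Ω.IsHyperbolicCurveOrigin X → Ω.IsDLocOrigin D.toDLocContext → X.K ≤ (D.curve Z).K)
    (haug : ∀ (X : TemperedCurve p) (D : DLocSchemeData X), Ω.IsHyperbolicCurveOrigin X →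
      Ω.IsDLocOrigin D.toDLocContext → letI := D.catK; letI := DLocObj.dlocCategory X;
        ∀ (Z : D.DLocK) (j : (D.pi1Functor.obj Z).J),
          (D.curve Z).aug (D.objIso Z j) = (D.pi1Functor.obj Z).augJ j)
    (hdictK : ∀ (X : TemperedCurve p) (D : DLocSchemeData X), Ω.IsHyperbolicCurveOrigin X →
      Ω.IsDLocOrigin D.toDLocContext → letI := D.catK; ∀ Z Z' : D.DLocK,
        ∃ (C : TemperedCurveHom p (D.curve Z) (D.curve Z')) (ι : (Z ⟶ Z') → C.DomHom),
          Ω.IsDomHomOrigin C ∧ Function.Injective ι ∧ (∀ f : Z ⟶ Z', C.pi1 (ι f) = D.pi1 f) ∧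
            ∀ f : C.DomHom,
              (∃ g : GQp p, ∀ x, (D.curve Z').aug (C.pi1 f x) = g * (D.curve Z).aug x * g⁻¹) →
              (∀ g : GQp p, (∀ x, (D.curve Z').aug (C.pi1 f x) = g * (D.curve Z).aug x * g⁻¹) →
                g ∈ X.GK) → f ∈ Set.range ι) :
    ∀ (X : TemperedCurve p) (D : DLocSchemeData X), Ω.IsHyperbolicCurveOrigin X →
      Ω.IsDLocOrigin D.toDLocContext → PiFunctorBijectiveOnHom X D := by
  intro X D hX hD
  letI := D.catK; letI := DLocObj.dlocCategory X
  choose C ι hC hι hpi hrangeK using hdictK X D hX hD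
  exact piFunctorBijectiveOnHom_of_temperedAnabelianTheorem_of_KMorphismLaw D C ι hι hpi hrangeK
    (fun Z => hK X D Z hX hD) (haug X D hX hD)
    fun Z Z' => h64 _ _ (C Z Z') (hcurve X D Z hX hD) (hcurve X D Z' hX hD) (hC Z Z')

/-- **[SemiAnbd] Thm. 6.8 (i)(ii), genuine-morphism form (F-1698), REDUCED to named leaves with the
morphism half DERIVED from Thm. 6.4 and the purely definitional `K`-morphism dictionary**: the closer
of record `dlocGroupTheoreticityGenuineHolds_of_parts` with `hL04` REPLACED by F-1693 (BY NAME) + the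
sharpened dictionary (`piFunctorBijectiveOnHom_of_temperedAnabelianTheoremHolds_of_KMorphismLaw`).
Nothing of [SemiAnbd]/[GalSect] is asserted. [cite: MochizukiSemiAnbd2006, Thm 6.8(i)-(ii) pp.74-75]
[cite: MochizukiGalSect2005, Thm 2.3 p.9] -/
theorem dlocGroupTheoreticityGenuineHolds_of_parts_of_thm64_of_KMorphismLaw
    (Ω : TemperedMorphismOrigin p) (h64 : Ω.TemperedAnabelianTheoremHolds)
    (hcurve : ∀ (X : TemperedCurve p) (D : DLocSchemeData X) (Z : D.DLocK),
      Ω.IsHyperbolicCurveOrigin X → Ω.IsDLocOrigin D.toDLocContext →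
        Ω.IsHyperbolicCurveOrigin (D.curve Z))
    (hK : ∀ (X : TemperedCurve p) (D : DLocSchemeData X) (Z : D.DLocK),
      Ω.IsHyperbolicCurveOrigin X → Ω.IsDLocOrigin D.toDLocContext → X.K ≤ (D.curve Z).K)
    (haug : ∀ (X : TemperedCurve p) (D : DLocSchemeData X), Ω.IsHyperbolicCurveOrigin X →
      Ω.IsDLocOrigin D.toDLocContext → letI := D.catK; letI := DLocObj.dlocCategory X;
        ∀ (Z : D.DLocK) (j : (D.pi1Functor.obj Z).J),
          (D.curve Z).aug (D.objIso Z j) = (D.pi1Functor.obj Z).augJ j)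
    (hdictK : ∀ (X : TemperedCurve p) (D : DLocSchemeData X), Ω.IsHyperbolicCurveOrigin X →
      Ω.IsDLocOrigin D.toDLocContext → letI := D.catK; ∀ Z Z' : D.DLocK,
        ∃ (C : TemperedCurveHom p (D.curve Z) (D.curve Z')) (ι : (Z ⟶ Z') → C.DomHom),
          Ω.IsDomHomOrigin C ∧ Function.Injective ι ∧ (∀ f : Z ⟶ Z', C.pi1 (ι f) = D.pi1 f) ∧
            ∀ f : C.DomHom,
              (∃ g : GQp p, ∀ x, (D.curve Z').aug (C.pi1 f x) = g * (D.curve Z).aug x * g⁻¹) →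
              (∀ g : GQp p, (∀ x, (D.curve Z').aug (C.pi1 f x) = g * (D.curve Z).aug x * g⁻¹) →
                g ∈ X.GK) → f ∈ Set.range ι)
    (hL02 : ∀ (X : TemperedCurve p) (D : DLocSchemeData X), Ω.IsHyperbolicCurveOrigin X →
      Ω.IsDLocOrigin D.toDLocContext → ObjectsHitOnTheNose X D)
    (hB4 : ∀ (X : TemperedCurve p) (D : DLocSchemeData X), Ω.IsHyperbolicCurveOrigin X →
      Ω.IsDLocOrigin D.toDLocContext → CuspImageOpenInDecomp X D)
    (hB1 : ∀ X : TemperedCurve p, Ω.IsHyperbolicCurveOrigin X → DecompCompact X)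
    (h65 : Ω.CuspidalAbsolutenessHolds) (h65i : Ω.TemperedDecompositionGroupsHolds)
    (hΔ : ∀ X Y : TemperedCurve p, Ω.IsHyperbolicCurveOrigin X → Ω.IsHyperbolicCurveOrigin Y →
      ∀ α : X.PiTemp ≃ₜ* Y.PiTemp, X.DeltaTemp.map α.toMulEquiv.toMonoidHom = Y.DeltaTemp) :
    Ω.DLocGroupTheoreticityGenuineHolds :=
  Ω.dlocGroupTheoreticityGenuineHolds_of_parts hcurve hL02
    (Ω.piFunctorBijectiveOnHom_of_temperedAnabelianTheoremHolds_of_KMorphismLaw h64 hcurve hK haug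
      hdictK) hB4 hB1 h65 h65i hΔ

end TemperedMorphismOrigin

end Literature.AnabelianGeometry.SemiGraphs
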